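import Summits.BirchSwinnertonDyer.Rank1Residual.X11b.LocalKernelNonsingularPrimary
import Summits.BirchSwinnertonDyer.Rank1Residual.X11b.LocalKernelCoinvariantsLower
import Summits.BirchSwinnertonDyer.Rank1Residual.X11b.AnticyclotomicControlAtoms
import Summits.BirchSwinnertonDyer.Rank1Residual.X11b.CoinvariantsDescent
import Summits.BirchSwinnertonDyer.Rank1Residual.X11b.LocalPointsPrimaryComponent
import Literature.NumberTheory.EllipticCurves.BSDQuadraticDescentTorsionOddPartProofs
import HarnessLib

/-!
# X11b, route R1 — `#ker(H¹(K_v, E[p^∞]) → H¹(K_{∞,η}, E[p^∞])) = c_v^{(p)}` at every place finitely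
# decomposed in `K_∞` via the `E₀`-part and the `p`-Sylow of `Φ_v` (Greenberg's Lemma 3.3, bad case,
# EXACT — second derivation; atom (P11))

HONEST FRAMING (cell `b2b-bsdres`, run/shared/lean/b2b/bsd-rank1-residual/, verbatim in every
file): the goal of the cell is to DELETE the COMBINATION-SHAPED residual classes of the
Birch–Swinnerton-Dyer formula for ALL analytic-rank `≤ 1` elliptic curves over `ℚ` — "full BSD
formula for every rank `≤ 1` curve in class `C`" assembled STRICTLY from published theorems — so
that the rank-`≤ 1` remainder becomes exactly the CONSTRUCTION-SHAPED classes, which are TYPED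
(missing-input `Prop`s), NOT attempted. This is not "finishing BSD". Sub-cell
`b2b-bsdres-multr1-p1` (X11b, route R1 = Castella 2018 Thm. A re-proved along the author's
erratum); a RESEARCH ROUTE; no claim beyond the stated class; X11b stays CONSTRUCTION-SHAPED;
nothing here changes a label; no named fact is minted (theorems only; no definition; no `sorry`).

## What this file proves

* (input, sibling file `LocalPointsPrimaryComponent`) `exists_torsion_sub_mem_nonsingularReductionSubgroup`:
  the `p`-Sylow of `Φ_v = X(K_v)/X₀(K_v)` is reached by rational `p`-power torsion (Silverman VII.6.3).
* **`relIndex_nonsingularPrimary_ker_eq_pow`** — `[E[p^∞]^{D_v} : E[p^∞]^{D_v} ⊓ B₀] = p^{ord_p c_v(E/K)}`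
  (`B₀ = E₀`-part of `B_v`, gen 18 `nonsingularPrimary`): Galois descent `E[p^∞]^{D_v} → X(K_v)`
  (as in route p2's (g4)) is additive with kernel-of-`X₀` equal to `B₀`, and its image in `Φ_v` is
  EXACTLY `Φ_v[p^∞]` (torsion points of `X(K_v)` are algebraic, `exists_pointsMapOfEmb_eq_of_nsmul_eq_zero`),
  of order `p^{ord_p #Φ_v} = p^{ord_p c_v}`.
* **`natCard_localKer_eq_pow_padicValNat_localTamagawaNumber`** — for every elliptic curve `E`
  over a number field `K`, every `ℤ_p`-extension `κ`, every finite place `v ∤ p` NOT split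
  completely in `K_∞/K`: `ker r_v` is finite of order EXACTLY `p^{ord_p c_v(E/K)}` (route p2's
  upper bound `natCard_localKer_le_pow_padicValNat_localTamagawaNumber` + gen 18's lower bound
  `relIndex_ker_decompSubOne_le_natCard_localKer`).
* Atom (P11) `LocalKernelOrderAt E p κ v` itself at such places is the tree's
  `localKernelOrderAt_of_not_le` (route p2, multr1-p2 gen 20, `BDPRouteLocalKernelExact`: the same
  squeeze with p2's purity count `p^{ord_p c_v} ∣ [B_v : (γ_v − 1)B_v]` as the lower bound and this
  sub-cell's `natCard_localKer_eq_natCard_quotient_range_decompSubOne` as the transport). THIS file is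
  the INDEPENDENT second derivation of the exact order through the `E₀`-part `B₀` and the `p`-Sylow
  of the component group (gen 18's `LocalKernelCoinvariantsLower` / `LocalKernelNonsingularPrimary` /
  `LocalPointsPrimaryComponent`), recorded so that both packagings are kernel-checked.

What is NOT here: the input "`v` finitely decomposed" at the split `w ∣ N⁺` of the anticyclotomic
tower — class field theory (Brink 2007, cited fact
`ZpExtension.decomp_not_le_kerSubgroup_of_isAnticyclotomic`); the class-level consequence for
route R1 is the next file.

References: [GreenbergLNM1716] §3 Lemma 3.3 (p. 87), §4 proof of Thm. 4.1 (pp. 74–75);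
[JetchevSkinnerWan2017] Prop. 3.3.4 Case 1(a)/2(a) (arXiv:1512.06894 pp. 12–13); [SilvermanAEC2009]
VII.§2, VII.3.1, §VII.6 (Thm. 6.1, Cor. 6.2, Prop. 6.3, Ex. 7.6), VIII.§1; [MilneADT2006] I Lemma 3.3.
-/

noncomputable section

open scoped Classical NNReal

open NumberField IsDedekindDomain Field Function WeierstrassCurve
open Literature.NumberTheory.EllipticCurves Literature.NumberTheory.EllipticCurves.GreenbergSelmer
open Literature.NumberTheory.GaloisRepresentations

namespace Summit.BirchSwinnertonDyer.Rank1Residual.X11b.AcSelmer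

variable {K : Type} [Field K] [NumberField K] {W : WeierstrassCurve K} {v : HeightOneSpectrum (𝓞 K)}

/-! ## 1. `[E[p^∞]^{D_v} : E[p^∞]^{D_v} ⊓ B₀] = p^{ord_p c_v}` -/

section Count

variable {w : Valuation (AlgebraicClosure (v.adicCompletion K)) ℝ≥0}
  (hw : ∀ x, (w x : ℝ) =
    spectralNorm (v.adicCompletion K) (AlgebraicClosure (v.adicCompletion K)) x)
  {W₀ : WeierstrassCurve w.integer}
  (hW₀ : ((W.localMinimalIntegralModel v).map (algebraMap (v.adicCompletionIntegers K)
      (v.adicCompletion K))).baseChange (AlgebraicClosure (v.adicCompletion K)) =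
    W₀.baseChange (AlgebraicClosure (v.adicCompletion K)))
  {Φ : localPoints W (v.adicCompletion K) ≃+
    (((W.localMinimalIntegralModel v).map (algebraMap (v.adicCompletionIntegers K)
      (v.adicCompletion K))).baseChange (AlgebraicClosure (v.adicCompletion K))).toAffine.Point}
  (hΦ : ∀ (σ : absoluteGaloisGroup (v.adicCompletion K)) (Q : localPoints W (v.adicCompletion K)),
    Φ (σ • Q) = Affine.Point.map ((absoluteGaloisGroup.toAlgEquiv _ σ :
        AlgebraicClosure (v.adicCompletion K) ≃ₐ[v.adicCompletion K]
          AlgebraicClosure (v.adicCompletion K)) :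
        AlgebraicClosure (v.adicCompletion K) →ₐ[v.adicCompletion K]
          AlgebraicClosure (v.adicCompletion K)) (Φ Q))
  {p : ℕ} [Fact p.Prime] (κ : ZpExtension K p)

include hw hΦ in
/-- **`[E[p^∞]^{D_v} : E[p^∞]^{D_v} ⊓ B₀] = p^{ord_p c_v(E/K)}`.** For `g ∈ D_v` generating `D_v`
topologically modulo `D_v ⊓ ker κ` (so that `ker(g − 1) = E[p^∞]^{D_v}` on `B_v`,
`decompSubOne_primary_eq_zero_iff`), the index of the non-singular part `B₀ = nonsingularPrimary`
in `ker(g − 1)` is the order of the `p`-Sylow subgroup of `Φ_v = X(K_v)/X₀(K_v)`, a group of order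
`c_v` (`localTamagawaNumber_eq_index_nonsingularReductionSubgroup`): Galois descent
`E[p^∞]^{D_v} → X(K_v)` (route p2's (g4) construction) followed by `X(K_v) → Φ_v` has kernel
`E[p^∞]^{D_v} ⊓ B₀` and image `Φ_v[p^∞]` (`exists_torsion_sub_mem_nonsingularReductionSubgroup`;
torsion points are algebraic). Greenberg, p. 74: "the index … is exactly the `p`-part `c_v^{(p)}`".
[cite: GreenbergLNM1716, §3 Lemma 3.3 (p. 87) and §4 proof of Thm. 4.1 (p. 74)]
[cite: SilvermanAEC2009, §VII.6 (Ex. 7.6) and VIII.§1] -/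
theorem relIndex_nonsingularPrimary_ker_eq_pow [W.IsElliptic] (hpv : (p : 𝓞 K) ∉ v.asIdeal)
    {𝔐 : Ideal v.localAbsIntegers} (h𝔐 : 𝔐 ∈ v.localPrimesAbove)
    {g : ↥((⊤ : Subgroup (absoluteGaloisGroup K)) ⊓ decomp v)}
    (hgen : ∀ U : Subgroup ↥((⊤ : Subgroup (absoluteGaloisGroup K)) ⊓ decomp v),
      IsOpen (U : Set ↥((⊤ : Subgroup (absoluteGaloisGroup K)) ⊓ decomp v)) →
        κ.kerSubgroup.subgroupOf ((⊤ : Subgroup (absoluteGaloisGroup K)) ⊓ decomp v) ≤ U →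
          g ∈ U → U = ⊤) :
    (nonsingularPrimary W κ hW₀ Φ hpv).relIndex
        (decompSubOne κ (W.geomPrimaryTorsion p) (g : absoluteGaloisGroup K)
          (Subgroup.mem_inf.mp g.2).2).ker =
      p ^ padicValNat p
        ((W.baseChange (v.adicCompletion K)).localTamagawaNumber (v.adicCompletionIntegers K)) := by
  have hp : (p : ℕ).Prime := Fact.out
  have hgD : (g : absoluteGaloisGroup K) ∈ decomp v := (Subgroup.mem_inf.mp g.2).2
  -- notation
  let X := (W.localMinimalIntegralModel v).map (algebraMap (v.adicCompletionIntegers K)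
    (v.adicCompletion K))
  haveI : X.IsElliptic := W.isElliptic_map_localMinimalIntegralModel (v := v)
  let Tor := W.geomPrimaryTorsion p
  let B := FixedPoints.addSubgroup ↥(κ.kerSubgroup ⊓ decomp v) Tor
  let ψ : B →+ B := decompSubOne κ Tor (g : absoluteGaloisGroup K) hgD
  let D : AddSubgroup B := ψ.ker
  let B₀ : AddSubgroup B := nonsingularPrimary W κ hW₀ Φ hpv
  let E₀K := (W.localMinimalIntegralModel v).nonsingularReductionSubgroup
    (integers_valuationRing_valuation (v.adicCompletionIntegers K) (v.adicCompletion K))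
  let ι := closureEmb (K := K) (v.adicCompletion K)
  have hXid : X.baseChange (v.adicCompletion K) = X := by
    change X.map (algebraMap (v.adicCompletion K) (v.adicCompletion K)) = X
    rw [Algebra.algebraMap_self, WeierstrassCurve.map_id]
  -- the underlying geometric point of `P ∈ D` is `D_v`-fixed
  have hDfix : ∀ P : D, ∀ x ∈ decomp v,
      x • (((P : B) : Tor) : W.geomPoints) = (((P : B) : Tor) : W.geomPoints) := by
    intro P x hx
    have h := (decompSubOne_primary_eq_zero_iff W κ hgen (P : B)).mp ((AddMonoidHom.mem_ker).mp P.2) x hx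
    have h' := congrArg (fun z : Tor ↦ (z : W.geomPoints)) h
    simpa only [primaryComponent.coe_smul] using h'
  have hfixD : ∀ (P : D) (σ : absoluteGaloisGroup (v.adicCompletion K)),
      Affine.Point.map ((absoluteGaloisGroup.toAlgEquiv _ σ :
          AlgebraicClosure (v.adicCompletion K) ≃ₐ[v.adicCompletion K]
            AlgebraicClosure (v.adicCompletion K)) :
          AlgebraicClosure (v.adicCompletion K) →ₐ[v.adicCompletion K]
            AlgebraicClosure (v.adicCompletion K))
        (Φ (pointsMapOfEmb W ι (((P : B) : Tor) : W.geomPoints))) =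
        Φ (pointsMapOfEmb W ι (((P : B) : Tor) : W.geomPoints)) := by
    intro P σ
    rw [← transport_pointsMapOfEmb_smul hΦ]
    congr 2
    exact hDfix P _ (resGalOfEmb_closureEmb_mem_decomp v σ)
  -- Galois descent `d₀ : D → X(K_v)`
  have hdesc : ∀ P : D, ∃ R : (X.baseChange (v.adicCompletion K)).toAffine.Point,
      Affine.Point.map (W' := X)
        (Algebra.ofId (v.adicCompletion K) (AlgebraicClosure (v.adicCompletion K))) R =
        Φ (pointsMapOfEmb W ι (((P : B) : Tor) : W.geomPoints)) :=
    fun P ↦ exists_point_map_eq_of_forall_map_eq X (hfixD P)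
  choose d₀ hd₀ using hdesc
  have hinj := Affine.Point.map_injective (W' := X)
    (Algebra.ofId (v.adicCompletion K) (AlgebraicClosure (v.adicCompletion K)))
  have hd₀_zero : d₀ 0 = 0 := hinj (by
    rw [hd₀, map_zero]
    change Φ (pointsMapOfEmb W ι (((0 : B) : Tor) : W.geomPoints)) = 0
    rw [ZeroMemClass.coe_zero, ZeroMemClass.coe_zero, map_zero, map_zero])
  have hd₀_add : ∀ P Q : D, d₀ (P + Q) = d₀ P + d₀ Q := fun P Q ↦ hinj (by
    rw [map_add, hd₀, hd₀, hd₀]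
    change Φ (pointsMapOfEmb W ι ((((P : B) + (Q : B) : B) : Tor) : W.geomPoints)) = _
    rw [AddSubgroup.coe_add, AddSubgroup.coe_add, map_add, map_add])
  let d : D →+ ((W.localMinimalIntegralModel v).baseChange (v.adicCompletion K)).toAffine.Point :=
    { toFun := fun P ↦ Affine.Point.congrEquiv hXid (d₀ P)
      map_zero' := by
        change Affine.Point.congrEquiv hXid (d₀ 0) = 0
        rw [hd₀_zero, map_zero]
      map_add' := fun P Q ↦ by
        change Affine.Point.congrEquiv hXid (d₀ (P + Q)) =
          Affine.Point.congrEquiv hXid (d₀ P) + Affine.Point.congrEquiv hXid (d₀ Q)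
        rw [hd₀_add, map_add] }
  have hd : ∀ P : D, d P = Affine.Point.congrEquiv hXid (d₀ P) := fun _ ↦ rfl
  -- `d P ∈ X₀(K_v) ↔ P ∈ B₀`
  have hbridge : ∀ P : D, d P ∈ E₀K ↔ (P : B) ∈ B₀ := by
    intro P
    rw [mem_nonsingularReductionSubgroup_iff, mem_nonsingularPrimary_iff, mem_nonsingularPart_iff,
      coe_toInertiaFixed_apply, hd, ← hd₀ P]
    obtain hR0 | ⟨x₀, y₀, hxy, hR⟩ : d₀ P = 0 ∨ ∃ x₀ y₀ h, d₀ P = .some x₀ y₀ h := by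
      rcases d₀ P with _ | ⟨x, y, h⟩
      exacts [Or.inl rfl, Or.inr ⟨x, y, h, rfl⟩]
    · rw [hR0, map_zero, map_zero, map_zero]
      exact iff_of_true WeierstrassCurve.hasNonsingularReduction_zero
        WeierstrassCurve.hasNonsingularReduction_zero
    · rw [hR, Affine.Point.congrEquiv_some, Affine.Point.map_some, Affine.Point.congrEquiv_some]
      exact (hasNonsingularReduction_algebraMap_iff hw (W.localMinimalIntegralModel v) h𝔐 hW₀
        _ _).symm
  -- `δ : D → Φ_v = X(K_v)/X₀(K_v)`, kernel `D ⊓ B₀`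
  let δ : D →+ _ ⧸ E₀K := (QuotientAddGroup.mk' E₀K).comp d
  have hδ : ∀ P : D, δ P = QuotientAddGroup.mk (d P) := fun _ ↦ rfl
  have hker : δ.ker = B₀.addSubgroupOf D := by
    ext P
    rw [AddMonoidHom.mem_ker, AddSubgroup.mem_addSubgroupOf, hδ, QuotientAddGroup.eq_zero_iff, hbridge]
  have h1 : B₀.relIndex D = δ.ker.index := by rw [hker]; rfl
  -- finiteness of `Φ_v`, of order `c_v`
  have hcv : (W.baseChange (v.adicCompletion K)).localTamagawaNumber (v.adicCompletionIntegers K) =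
      E₀K.index := localTamagawaNumber_eq_index_nonsingularReductionSubgroup W v
  have hcv0 : (W.baseChange (v.adicCompletion K)).localTamagawaNumber (v.adicCompletionIntegers K) ≠ 0 :=
    W.localTamagawaNumber_baseChange_ne_zero v
  haveI hE₀fi : E₀K.FiniteIndex := ⟨by rw [← hcv]; exact hcv0⟩
  haveI : Finite (((W.localMinimalIntegralModel v).baseChange (v.adicCompletion K)).toAffine.Point ⧸ E₀K) :=
    AddSubgroup.finite_quotient_of_finiteIndex
  -- the image of `δ` is the `p`-primary component of `Φ_v`
  have hrange : δ.range = AddCommGroup.primaryComponent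
      (((W.localMinimalIntegralModel v).baseChange (v.adicCompletion K)).toAffine.Point ⧸ E₀K) p := by
    apply le_antisymm
    · rintro _ ⟨P, rfl⟩
      obtain ⟨k, hk⟩ := (AddCommGroup.mem_primaryComponent (G := W.geomPoints)).mp ((P : B) : Tor).2
      refine (AddCommGroup.mem_primaryComponent).mpr ⟨k, ?_⟩
      rw [← map_nsmul]
      have hP0 : p ^ k • P = 0 := by
        apply Subtype.ext; apply Subtype.ext; apply Subtype.ext
        rw [AddSubgroupClass.coe_nsmul, AddSubgroupClass.coe_nsmul, AddSubgroupClass.coe_nsmul, hk]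
        rfl
      rw [hP0, map_zero]
    · intro y hy
      obtain ⟨k, hk⟩ := (AddCommGroup.mem_primaryComponent).mp hy
      obtain ⟨x, rfl⟩ := QuotientAddGroup.mk_surjective y
      have hkx : p ^ k • x ∈ E₀K := by
        rw [← QuotientAddGroup.eq_zero_iff, QuotientAddGroup.mk_nsmul]; exact hk
      -- a rational `p`-power torsion point `t ≡ x`
      obtain ⟨t, ⟨s, hts⟩, htx⟩ :=
        exists_torsion_sub_mem_nonsingularReductionSubgroup W hpv x ⟨k, hkx⟩
      -- `t` comes from a `D_v`-fixed `p`-power torsion point `Pt ∈ E(K̄)`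
      set t₁ := (Affine.Point.congrEquiv hXid).symm t with ht₁
      set Q := Affine.Point.map (W' := X)
        (Algebra.ofId (v.adicCompletion K) (AlgebraicClosure (v.adicCompletion K))) t₁ with hQ
      have ht₁s : p ^ s • t₁ = 0 := by
        rw [ht₁, ← map_nsmul]
        exact (congrArg _ hts).trans (map_zero _)
      have hQs : p ^ s • Q = 0 := by rw [hQ, ← map_nsmul, ht₁s, map_zero]
      obtain ⟨Pt, hPts, hPt⟩ := exists_pointsMapOfEmb_eq_of_nsmul_eq_zero W ι
        (pow_ne_zero s hp.ne_zero) (Q := Φ.symm Q) (by rw [← map_nsmul, hQs, map_zero])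
      have hΦPt : Φ (pointsMapOfEmb W ι Pt) = Q := by rw [hPt, AddEquiv.apply_symm_apply]
      have hPtfix : ∀ x ∈ decomp v, x • Pt = Pt := by
        intro x hx
        obtain ⟨σ, rfl⟩ := exists_eq_resGalOfEmb_of_mem_decomp v hx
        apply pointsMapOfEmb_injective W ι
        apply Φ.injective
        rw [transport_pointsMapOfEmb_smul hΦ, hΦPt, hQ]
        exact map_toAlgEquiv_map_ofId X t₁ σ
      have hPtprim : Pt ∈ W.geomPrimaryTorsion p :=
        (AddCommGroup.mem_primaryComponent).mpr ⟨s, hPts⟩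
      let bP : B := ⟨⟨Pt, hPtprim⟩, fun x ↦ Subtype.ext (by
        rw [Subgroup.smul_def, primaryComponent.coe_smul]
        exact hPtfix _ (Subgroup.mem_inf.mp x.2).2)⟩
      have hbP : bP ∈ D := by
        rw [AddMonoidHom.mem_ker, decompSubOne_primary_eq_zero_iff W κ hgen]
        intro x hx
        exact Subtype.ext (by rw [primaryComponent.coe_smul]; exact hPtfix x hx)
      refine ⟨⟨bP, hbP⟩, ?_⟩
      -- `d ⟨bP⟩ = t`
      have hdt : d ⟨bP, hbP⟩ = t := by
        rw [hd]
        have : d₀ ⟨bP, hbP⟩ = t₁ := hinj (by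
          rw [hd₀]
          change Φ (pointsMapOfEmb W ι Pt) = _
          rw [hΦPt, hQ])
        rw [this, ht₁, AddEquiv.apply_symm_apply]
      rw [hδ, hdt, QuotientAddGroup.eq_iff_sub_mem]
      exact htx
  -- count
  rw [h1, AddSubgroup.index_ker, hrange, natCard_primaryComponent_eq_pow_padicValNat p, hcv,
    AddSubgroup.index_eq_card]

end Count

/-! ## 2. Assembly: `#ker r_v = c_v^{(p)}` at a place finitely decomposed in `K_∞` -/

section Assembly

variable (W) {p : ℕ} [Fact p.Prime] (κ : ZpExtension K p)

/-- **Greenberg's Lemma 3.3 at a bad place, EXACT, on the constructed objects.** For an elliptic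
curve `E` over a number field `K`, a prime `p`, a `ℤ_p`-extension `κ` (`K_∞ = K̄^{ker κ}`) and a
finite place `v ∤ p` of `K` that does NOT split completely in `K_∞/K` (`¬ D_v ≤ ker κ`): the local
kernel `ker r_v = ker (H¹(K_v, E[p^∞]) → H¹(K_{∞,η}, E[p^∞]))` (`localKer (ker κ) E[p^∞] v`) is finite
of order EXACTLY `p ^ ord_p c_v(E/K)`. Upper bound: route p2
(`natCard_localKer_le_pow_padicValNat_localTamagawaNumber`). Lower bound: `#ker r_v = #B_v/(γ_v−1)B_v ≥
[B_v^{γ_v} : B_v^{γ_v} ⊓ B₀] = #Φ_v[p^∞] = c_v^{(p)}` (`relIndex_ker_decompSubOne_le_natCard_localKer`,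
`relIndex_nonsingularPrimary_ker_eq_pow`). Greenberg: "`ker(r_v)` … has order exactly `c_v^{(p)}`"
(p. 74; Lemma 3.3 p. 87 with `v` finitely decomposed). [cite: GreenbergLNM1716, §3 Lemma 3.3 (p. 87) and §4 proof of Thm. 4.1 (pp. 74–75)]
[cite: JetchevSkinnerWan2017, Prop. 3.3.4 Case 1(a) (arXiv:1512.06894 pp. 12–13)] -/
theorem natCard_localKer_eq_pow_padicValNat_localTamagawaNumber [W.IsElliptic]
    (hpv : (p : 𝓞 K) ∉ v.asIdeal) (hv : ¬ decomp v ≤ κ.kerSubgroup) :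
    Finite (localKer κ.kerSubgroup (W.geomPrimaryTorsion p) v) ∧
      Nat.card (localKer κ.kerSubgroup (W.geomPrimaryTorsion p) v) =
        p ^ padicValNat p
          ((W.baseChange (v.adicCompletion K)).localTamagawaNumber (v.adicCompletionIntegers K)) := by
  obtain ⟨hfin, hle⟩ := natCard_localKer_le_pow_padicValNat_localTamagawaNumber W κ hpv
  haveI := hfin
  refine ⟨hfin, le_antisymm hle ?_⟩
  -- local data
  obtain ⟨w, hw⟩ := v.exists_spectralValuation
  obtain ⟨𝔐, h𝔐⟩ := v.localPrimesAbove_nonempty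
  have hint := WeierstrassCurve.isIntegral_spectralValuation_baseChange hw
    (W.localMinimalIntegralModel v)
  obtain ⟨W₀, hW₀⟩ := hint.integral
  obtain ⟨C, hC⟩ := W.exists_variableChange_eq_localMinimalIntegralModel v
  obtain ⟨Φ, hΦ⟩ := W.exists_addEquiv_localPoints_of_smul_eq v hC
  -- a generator of `D_v` modulo `D_v ⊓ ker κ`
  obtain ⟨g, hgen⟩ := exists_mem_decomp_generate κ v
  have hgD : (g : absoluteGaloisGroup K) ∈ decomp v := (Subgroup.mem_inf.mp g.2).2
  -- the lower bound with `B₀ = nonsingularPrimary`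
  haveI := finite_quotient_nonsingularPrimary (κ := κ) hW₀ (Φ := Φ) hw hΦ hpv
  have hlow := relIndex_ker_decompSubOne_le_natCard_localKer κ (W.geomPrimaryTorsion p)
    (W.continuous_smul_geomPrimaryTorsion p) (Coinv.isPrimaryTorsion_geomPrimaryTorsion W p) hv hgen
    (nonsingularPrimary W κ hW₀ Φ hpv)
    (fun b hb ↦ decompSubOne_mem_nonsingularPrimary hW₀ hw hΦ hpv hgD hb)
  rwa [relIndex_nonsingularPrimary_ker_eq_pow hw hW₀ hΦ κ hpv h𝔐 hgen] at hlow

end Assembly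

end Summit.BirchSwinnertonDyer.Rank1Residual.X11b.AcSelmer

end
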